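import Summits.BirchSwinnertonDyer.BirchSwinnertonDyer.Theorems.ByReductionTypeAtTwoAdditiveKatoEulerSystemClassNeZeroAtTwo
import Summits.BirchSwinnertonDyer.BirchSwinnertonDyer.Theorems.ByReductionTypeAtTwoSupersingularSelmerCorankCyclotomicLayersBounded
import Literature.NumberTheory.EllipticCurves.Kato2004.EulerSystemBoundFineSelmerTwo
import Summits.BirchSwinnertonDyer.Rank1Residual.P2.EmptyCellsAtTwo
import HarnessLib

/-!
# Route `ByReductionTypeAtTwo` (rung K4), crux `SupersingularRankZeroAtTwo` (item stmt-BirchSwinnertonDyer-19097), stub 2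
# `stub_allFlatData`, clause CK♭-F4rat: KATO'S EULER-SYSTEM BOUND AT THE HEIGHT-ONE PRIMES `∌ 2`, on EVERY good-supersingular-at-`2`
# non-CM curve, BY NAME MODULO PRINT — `ℓ_𝔭(X₀(E/ℚ_∞)) ≤ ℓ_𝔭(𝐇¹_Γ(T₂E)/Λs)` for a NON-ZERO genuine `2`-adic Euler-system class `s`
# (hand H2-K of `HOME/ss/gen24/HAND-TARGETS-FLATDATA-1.md`)

HONEST FRAMING (cell `bsd-2adic`, run/shared/lean/pub/bsd-2adic/, seat `bsd-2adic-ss-1` GEN 24 = LEAD lineage of 19097; HUMAN RULINGS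
D-0036 / D-0054 / D-0074): THEOREMS ONLY (no definition, no named fact, no instance, no `sorry`, axioms the standard trio); CONDITIONAL on
THREE named PRINT facts displayed as binders — (hES) `Kato2004.exists_eulerSystem_expStar_values` (Kato (8.1.3)/Ex. 13.3 with Thm. 9.7 and
Thm. 6.6 (1): the Euler system of `T₂E` exists with its dual-exponential values), (h134) `Kato2004.thm13_4_two_lengthAt_fineSelmerDual_le_of_isEulerSystemClassTwo`
(Kato Thm. 13.4 (2) at `p = 2`, the primes `∌ 2` — where Kato states Conj. 12.10 at `p = 2`), (hmod) modularity `nonempty_modularParametrizationData`;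
Rohrlich's theorem is a TREE THEOREM (`PSRohrlichAtLevel.rohrlich_primePow_of_isNewformOf`).  Closes no stub: the registered CK♭ clause binds its Kato-side
witnesses `(I, Y, Z)` TOGETHER with the ♭-side ones (`P, loc, toX, δ, G`: the ♭ Poitou–Tate sequence and the reciprocity `ι G = C(ϖ)·ι L♭`), which are
NOT produced here; nothing booked; BSD is not proved by any of this.

WHAT.  `flatKatoSide_two (hES) (h134) (hmod) : ∀ W [ell] [min], ¬CM → GoodSS W 2 → ∀ κ γ, κ.IsCyclotomic → κ.IsTopGenerator γ → ∀ (I : Kato2004.IwasawaH1Data W 2 κ γ),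
∃ s : I.H, IsEulerSystemClassTwo W hκ I s ∧ s ≠ 0 ∧ ∀ (Y : W.FineSelmerDualData κ γ) 𝔭, ht 𝔭 = 1 → C 2 ∉ 𝔭 → lengthAt Λ Y.X 𝔭 ≤ lengthAt Λ (I.H ⧸ Λ∙s) 𝔭` —
the F4rat conjunct of CK♭ with `Z = Λ∙s`, for EVERY pinned `I` and EVERY fine dual `Y`.  Assembly: modularity gives the newform `f` of `W`
(`ModularParametrizationData.isNewformOf`); `GoodSS W 2 ⇒ W[2]` irreducible (`P2.irr_two_of_goodSS_two`); the structure facts of `T₂W` are carried as INSTANCE BINDERS exactly as in (h134) and in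
`AddKatoTwo.exists_isEulerSystemClassTwo_ne_zero` (dischargeable by the tree theorems `module_free_tateModule_holds`, `module_finite_tateModule_holds`,
`TateModule.continuousSMul_padicInt`); then `AddKatoTwo.exists_isEulerSystemClassTwo_ne_zero`
(cell `bsd-2adic` addL2x GEN 20: a non-zero genuine `2`-adic Euler-system class in every pin, modulo (hES), Rohrlich fed from the kernel) and (h134).

References: K. Kato, Astérisque 295 (2004), Thm. 12.5 (1)/(3) (pp. 221–222), Thm. 13.4 (2) (p. 226), Ex. 13.3 (p. 225), Conj. 12.10 (p. 224);
D. Rohrlich, Invent. Math. 75 (1984); F. Sprung, J. Number Theory 132 (2012), §7 (the ♭ objects the clause serves).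
-/

set_option autoImplicit false
-- the Theorems namespace of this sub repeats the summit name by design (D-0017 nested layout: Summit.<S>.<Sub>)
set_option linter.dupNamespace false

noncomputable section

open scoped Classical NumberField

namespace Summit.BirchSwinnertonDyer.BirchSwinnertonDyer.Theorems.SSFlatRoad

open Field NumberField IsDedekindDomain WeierstrassCurve CongruenceSubgroup
  Literature.NumberTheory.EllipticCurves Literature.NumberTheory.EllipticCurves.ModularForms
  Literature.NumberTheory.EllipticCurves.Rank1Residual Literature.NumberTheory.GaloisRepresentations
  Summit.BirchSwinnertonDyer.Rank1Residual

/-- ★ **CK♭-F4rat BY NAME, modulo print: Kato's Euler-system bound at the height-one primes of `Λ = ℤ₂⟦X⟧` NOT containing `2`, on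
every non-CM good-supersingular-at-`2` curve, every cyclotomic `(κ, γ)`, every pin `I = 𝐇¹_Γ(T₂W)` and every fine dual `Y = X₀(W/ℚ_∞)`:
there is a NON-ZERO genuine `2`-adic Euler-system class `s ∈ 𝐇¹_Γ(T₂W)` with `ℓ_𝔭(Y) ≤ ℓ_𝔭(𝐇¹_Γ/Λ∙s)` for all such `𝔭`** — the conjunct
`∀ 𝔭 ht 1, C 2 ∉ 𝔭 → lengthAt Y.X 𝔭 ≤ lengthAt (I.H ⧸ Z) 𝔭` of stub 2's CK♭ clause with `Z = Λ∙s`.  GIVEN the three named facts (hES) Kato's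
Euler system with its `exp*` values, (h134) Kato Thm. 13.4 (2) at `p = 2`, (hmod) modularity; Rohrlich and `W[2]` irreducible (⟸ `GoodSS W 2`)
from the kernel.  No sorry of its own; CONDITIONAL on the displayed facts.
[cite: Kato2004Asterisque, Thm. 13.4 (2) (p. 226), Thm. 12.5 (1) (pp. 221–222), Ex. 13.3 (p. 225)] [cite: RohrlichInventiones1984, Theorem (p. 409)] -/
theorem flatKatoSide_two (hES : Kato2004.exists_eulerSystem_expStar_values)
    (h134 : Kato2004.thm13_4_two_lengthAt_fineSelmerDual_le_of_isEulerSystemClassTwo)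
    (hmod : nonempty_modularParametrizationData)
    (W : WeierstrassCurve ℚ) [W.IsElliptic] [W.IsGloballyMinimal]
    [ContinuousSMul ℤ_[2] (W.tateModule 2)] [Module.Free ℤ_[2] (W.tateModule 2)] [Module.Finite ℤ_[2] (W.tateModule 2)]
    (hCM : ¬ W.HasCM) (hss : GoodSS W 2)
    (κ : ZpExtension ℚ 2) (γ : Field.absoluteGaloisGroup ℚ) (hκ : κ.IsCyclotomic) (hγ : κ.IsTopGenerator γ)
    (I : Kato2004.IwasawaH1Data W 2 κ γ) :
    ∃ s : I.H, Kato2004.IsEulerSystemClassTwo W hκ I s ∧ s ≠ 0 ∧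
      ∀ (Y : W.FineSelmerDualData κ γ) (𝔭 : PrimeSpectrum (IwasawaAlgebra 2)), 𝔭.asIdeal.height = 1 →
        PowerSeries.C (2 : ℤ_[2]) ∉ 𝔭.asIdeal →
          Literature.NumberTheory.EllipticCurves.Module.lengthAt (IwasawaAlgebra 2) Y.X 𝔭 ≤
            Literature.NumberTheory.EllipticCurves.Module.lengthAt (IwasawaAlgebra 2)
              (I.H ⧸ Submodule.span (IwasawaAlgebra 2) {s}) 𝔭 := by
  -- the newform of `W` (modularity)
  haveI : NeZero (W.conductorNorm ℤ) := ⟨(W.conductorNorm_pos_holds).ne'⟩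
  obtain ⟨Dm⟩ := hmod W
  have hf : IsNewformOf W Dm.f := Dm.isNewformOf
  have hirr : W.HasIrreducibleModPGaloisRep 2 := P2.irr_two_of_goodSS_two W hss
  -- a non-zero genuine `2`-adic Euler-system class (Rohrlich from the kernel)
  obtain ⟨s, hs, hs0⟩ := AddKatoTwo.exists_isEulerSystemClassTwo_ne_zero W I hκ hES hirr Dm.f hf
  exact ⟨s, hs, hs0, fun Y 𝔭 h1 h2 ↦ h134 W hCM κ γ hκ hγ I Y s hs hs0 𝔭 h1 h2⟩

end Summit.BirchSwinnertonDyer.BirchSwinnertonDyer.Theorems.SSFlatRoad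

end
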